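import Summits.QuantumFields.YangMills.Theorems.BalabanUVNodesN15KingModelGaussianMoments

/-!
# BalabanUVNodes ∕ N15 — THE KING-MODEL RUNG (PART Ͱ-a, engine): GAUSSIAN INTEGRATION BY PARTS FOR THE DENSITY-DEFINED LAW `ρ_A dx` —
# `∫⟨J₀,x⟩∏_{i∈S}⟨J_i,x⟩ρ_A(x)dx = Σ_{k∈S}⟨J₀,A⁻¹J_k⟩∫∏_{i∈S∖k}⟨J_i,x⟩ρ_A(x)dx` (the WICK ∕ ISSERLIS RECURSION, every finite family of linear forms)
# (Track A, DAG node N15 = NE2; FAN-OUT v1.1 §N15 s3 «KING-MODEL RUNG»; uses parts Τ-a (tilt ∕ completing the square), Ϝ-q (`gaussDensity`), Ϝ-s (majorants);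
# count-neutral)

HONEST FRAMING.  Count-neutral (cell `pub-ymgap`, seat `pub-ymgap-dag-n15-e` g34; `--supports stmt-QuantumFields-27366 --as helper` = K3⁸
`SpineGivenEndpointR13SepCoPHV`).  Folklore finite-dimensional Gaussian calculus (Isserlis 1918 ∕ Wick 1950, the «integration by parts» form
`E[ξ₀·F] = Σ_k Cov(ξ₀,ξ_k)·E[∂_kF]` for a polynomial `F` in jointly Gaussian centred variables) for the DENSITY-defined law
`ρ_A(x)dx = e^{−½⟨x,Ax⟩}dx∕𝒩(A)` of a symmetric coercive precision `A` on `ℝ^ι` — the shape of every measure of [King1986] (C. King, Commun. Math.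
Phys. **102** (1986) 649–677) (2.6) p.652.  Part Ϝ-s proved the moments of ONE linear form up to order four by differentiating part Τ-a's tilt identity
along a line; this file proves the recursion that generates ALL mixed moments of ANY finite family of linear forms `⟨J_i,·⟩`, `i ∈ S` (part Ͱ-b turns
it into the closed form «moments are hafnians of the covariance Gram matrix» with the tree's `Literature.Combinatorics.Enumerative.hafnian`).
ROUTE (derivative in ONE auxiliary parameter only, no multi-index calculus): with `u_i = ⟨J_i,x⟩`, `F(t) := ∫∏_{i∈S}u_i·e^{tu₀}ρ_A`;
(1) `F′(0) = ∫u₀∏u_iρ_A` (dominated differentiation under `∫`, majorant `∏_{i∈S}(e^{u_i}+e^{−u_i})·(e^{cu₀}+e^{−cu₀})ρ_A`, integrable by induction on `S`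
from part Τ-a's tilt integrability); (2) COMPLETING THE SQUARE (part Τ-a): `e^{⟨w,x⟩}ρ_A(x) = e^{½⟨w,A⁻¹w⟩}ρ_A(x − A⁻¹w)` and translation invariance of
Lebesgue measure give `F(t) = e^{½t²Q₀}·P(t)`, `P(t) = ∫∏_{i∈S}(u_i + t·c_i)ρ_A`, `c_i = ⟨J_i,A⁻¹J₀⟩ = ⟨J₀,A⁻¹J_i⟩`, `Q₀ = ⟨J₀,A⁻¹J₀⟩`; (3) `P` is a
polynomial, `P(t) = Σ_{T⊆S}t^{|T|}(∏_{i∈T}c_i)·∫∏_{i∈S∖T}u_iρ_A` (`Finset.prod_add`), so `P′(0) = Σ_{k∈S}c_k∫∏_{i∈S∖k}u_iρ_A`, and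
`(e^{½t²Q₀})′(0) = 0`; (4) uniqueness of the derivative.  NOT a node discharge (N15 is booked through n15-a's knit, untouched here); nothing Bałaban ∕
continuum-Yang–Mills ∕ `ℝ⁴` ∕ OS ∕ mass-gap ∕ Clay.  0 `sorry`, 0 def; standard axioms.

WHAT THIS FILE PROVES (kernel).  §1 `abs_le_exp_add_exp_neg` (private), ★ `integrable_prod_cosh_mul_exp_mul_gaussDensity` (induction on `S`),
`integrable_prod_cosh_mul_cosh_mul_gaussDensity`, `abs_prod_dot_le_prod_cosh`, `continuous_prod_dot`, ★ `integrable_prod_dot_mul_exp_mul_gaussDensity`,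
`integrable_dot_mul_prod_dot_mul_exp_mul_gaussDensity`, ★ `integrable_prod_dot_mul_gaussDensity`; §2 ★★ **`gaussDensity_mul_exp_dot_eq_transl`** (completing the
square at the level of the density), ★★ `integral_mul_exp_dot_gaussDensity_eq_transl` (`∫G·e^{⟨w,·⟩}ρ_A = e^{½⟨w,A⁻¹w⟩}∫G(· + A⁻¹w)ρ_A`, every `G`);
§3 `prod_dot_add_smul_eq_sum` (the binomial expansion over `S.powerset`), `integral_prod_dot_add_smul_eq_sum`, `sum_card_mul_zero_pow_eq`,
★ `hasDerivAt_shiftPoly`; §4 ★★ `hasDerivAt_prodTilt` (differentiation under `∫`), ★★★ **`integral_dot_mul_prod_gaussDensity`** (THE RECURSION).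

HONEST SCOPE.  Finite-dimensional centred Gaussians only; folklore.  N15 untouched; counts unmoved.  Locators (use): [King1986] (2.6) p.652, (2.15) p.653.
-/

noncomputable section

open scoped BigOperators
open Finset Matrix Filter Topology MeasureTheory

namespace Summit.QuantumFields.YangMills.BalabanUVNodes.N15KingModelRung.FreeField

open Literature.MathematicalPhysics.QuantumFieldTheory.Balaban1983to89.QGQInverse (Coercive isUnit_of_coercive)

variable {ι : Type*} [Fintype ι] [DecidableEq ι]

/-! ## §1 Integrability of products of linear forms (times an exponential tilt) against `ρ_A` -/

section Integrability

variable {A : Matrix ι ι ℝ} {δ : ℝ} {W : Type*}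

omit [Fintype ι] [DecidableEq ι] in
/-- `|s| ≤ e^{s} + e^{−s}`. [folklore] -/
private theorem abs_le_exp_add_exp_neg (s : ℝ) : |s| ≤ Real.exp s + Real.exp (-s) := by
  have h1 := Real.add_one_le_exp s
  have h2 := Real.add_one_le_exp (-s)
  rcases le_total 0 s with h | h
  · rw [abs_of_nonneg h]; linarith [Real.exp_pos (-s)]
  · rw [abs_of_nonpos h]; linarith [Real.exp_pos s]

omit [DecidableEq ι] in
/-- ★ For every finite family of linear forms and every tilt `w`: `∏_{i∈S}(e^{⟨J_i,x⟩} + e^{−⟨J_i,x⟩})·e^{⟨w,x⟩}·ρ_A(x)` is integrable (induction on `S`: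
each new factor splits the integrand into two tilts `w ± J_a`; the base is part Τ-a's tilt integrability). [folklore] -/
theorem integrable_prod_cosh_mul_exp_mul_gaussDensity [DecidableEq W] (hδ : 0 < δ) (hA : Coercive A δ) (J : W → ι → ℝ)
    (S : Finset W) (w : ι → ℝ) :
    Integrable fun x : ι → ℝ =>
      (∏ i ∈ S, (Real.exp (J i ⬝ᵥ x) + Real.exp (-(J i ⬝ᵥ x)))) * Real.exp (w ⬝ᵥ x) * gaussDensity A x := by
  induction S using Finset.induction_on generalizing w with
  | empty =>
    simp only [Finset.prod_empty, one_mul]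
    exact integrable_exp_dot_gaussDensity hδ hA w
  | insert a S ha ih =>
    refine ((ih (w + J a)).add (ih (w - J a))).congr (Eventually.of_forall fun x => ?_)
    simp only [Pi.add_apply, Finset.prod_insert ha, add_dotProduct, sub_dotProduct, Real.exp_add, Real.exp_sub,
      Real.exp_neg]
    have hpos : Real.exp (J a ⬝ᵥ x) ≠ 0 := (Real.exp_pos _).ne'
    field_simp

omit [DecidableEq ι] in
/-- The same with one more «cosh pair» `e^{⟨w,x⟩} + e^{−⟨w,x⟩}` (sum of the two tilts `±w`). [folklore] -/
theorem integrable_prod_cosh_mul_cosh_mul_gaussDensity [DecidableEq W] (hδ : 0 < δ) (hA : Coercive A δ) (J : W → ι → ℝ)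
    (S : Finset W) (w : ι → ℝ) :
    Integrable fun x : ι → ℝ =>
      (∏ i ∈ S, (Real.exp (J i ⬝ᵥ x) + Real.exp (-(J i ⬝ᵥ x)))) * (Real.exp (w ⬝ᵥ x) + Real.exp (-(w ⬝ᵥ x)))
        * gaussDensity A x := by
  refine ((integrable_prod_cosh_mul_exp_mul_gaussDensity hδ hA J S w).add
    (integrable_prod_cosh_mul_exp_mul_gaussDensity hδ hA J S (-w))).congr (Eventually.of_forall fun x => ?_)
  simp only [Pi.add_apply, neg_dotProduct]
  ring

omit [DecidableEq ι] in
/-- `|∏_{i∈S}⟨J_i,x⟩| ≤ ∏_{i∈S}(e^{⟨J_i,x⟩} + e^{−⟨J_i,x⟩})`. [folklore] -/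
theorem abs_prod_dot_le_prod_cosh (J : W → ι → ℝ) (S : Finset W) (x : ι → ℝ) :
    |∏ i ∈ S, J i ⬝ᵥ x| ≤ ∏ i ∈ S, (Real.exp (J i ⬝ᵥ x) + Real.exp (-(J i ⬝ᵥ x))) := by
  rw [Finset.abs_prod]
  exact Finset.prod_le_prod (fun i _ => abs_nonneg _) fun i _ => abs_le_exp_add_exp_neg _

omit [DecidableEq ι] in
/-- `x ↦ ∏_{i∈S}⟨J_i,x⟩` is continuous. [folklore] -/
theorem continuous_prod_dot (J : W → ι → ℝ) (S : Finset W) : Continuous fun x : ι → ℝ => ∏ i ∈ S, J i ⬝ᵥ x := by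
  simp only [dotProduct]; fun_prop

omit [DecidableEq ι] in
/-- ★ `∏_{i∈S}⟨J_i,x⟩·e^{t⟨J₀,x⟩}·ρ_A(x)` is integrable. [folklore] -/
theorem integrable_prod_dot_mul_exp_mul_gaussDensity [DecidableEq W] (hδ : 0 < δ) (hA : Coercive A δ) (J : W → ι → ℝ)
    (S : Finset W) (J₀ : ι → ℝ) (t : ℝ) :
    Integrable fun x : ι → ℝ => (∏ i ∈ S, J i ⬝ᵥ x) * Real.exp (t * (J₀ ⬝ᵥ x)) * gaussDensity A x := by
  have hc : Continuous fun x : ι → ℝ => (∏ i ∈ S, J i ⬝ᵥ x) * Real.exp (t * (J₀ ⬝ᵥ x)) * gaussDensity A x := by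
    have hJ : Continuous fun x : ι → ℝ => J₀ ⬝ᵥ x := by simp only [dotProduct]; fun_prop
    exact ((continuous_prod_dot J S).mul (Real.continuous_exp.comp (continuous_const.mul hJ))).mul
      (continuous_gaussDensity A)
  refine (integrable_prod_cosh_mul_exp_mul_gaussDensity hδ hA J S (t • J₀)).mono' hc.aestronglyMeasurable
    (Eventually.of_forall fun x => ?_)
  have h0 : 0 ≤ gaussDensity A x := gaussDensity_nonneg hδ hA x
  rw [Real.norm_eq_abs, abs_mul, abs_mul, abs_of_nonneg h0, abs_of_pos (Real.exp_pos _), smul_dotProduct, smul_eq_mul]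
  exact mul_le_mul_of_nonneg_right
    (mul_le_mul_of_nonneg_right (abs_prod_dot_le_prod_cosh J S x) (Real.exp_pos _).le) h0

omit [DecidableEq ι] in
/-- `⟨J₀,x⟩·∏_{i∈S}⟨J_i,x⟩·e^{t⟨J₀,x⟩}·ρ_A(x)` is integrable (majorant with the extra pair `e^{±(|t|+1)⟨J₀,x⟩}`, part Ϝ-s's `abs_pow_mul_exp_le`).
[folklore] -/
theorem integrable_dot_mul_prod_dot_mul_exp_mul_gaussDensity [DecidableEq W] (hδ : 0 < δ) (hA : Coercive A δ)
    (J : W → ι → ℝ) (S : Finset W) (J₀ : ι → ℝ) (t : ℝ) :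
    Integrable fun x : ι → ℝ =>
      (J₀ ⬝ᵥ x) * (∏ i ∈ S, J i ⬝ᵥ x) * Real.exp (t * (J₀ ⬝ᵥ x)) * gaussDensity A x := by
  have hc : Continuous fun x : ι → ℝ =>
      (J₀ ⬝ᵥ x) * (∏ i ∈ S, J i ⬝ᵥ x) * Real.exp (t * (J₀ ⬝ᵥ x)) * gaussDensity A x := by
    have hJ : Continuous fun x : ι → ℝ => J₀ ⬝ᵥ x := by simp only [dotProduct]; fun_prop
    exact (((hJ.mul (continuous_prod_dot J S)).mul (Real.continuous_exp.comp (continuous_const.mul hJ))).mul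
      (continuous_gaussDensity A))
  refine (integrable_prod_cosh_mul_cosh_mul_gaussDensity hδ hA J S ((|t| + 1) • J₀)).mono' hc.aestronglyMeasurable
    (Eventually.of_forall fun x => ?_)
  have h0 : 0 ≤ gaussDensity A x := gaussDensity_nonneg hδ hA x
  have h1 : |(J₀ ⬝ᵥ x) * Real.exp (t * (J₀ ⬝ᵥ x))|
      ≤ Real.exp ((|t| + 1) * (J₀ ⬝ᵥ x)) + Real.exp (-((|t| + 1) * (J₀ ⬝ᵥ x))) := by
    have h := abs_pow_mul_exp_le 1 (le_refl |t|) (J₀ ⬝ᵥ x)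
    simp only [pow_one, Nat.cast_one] at h
    exact h
  have hre : (J₀ ⬝ᵥ x) * (∏ i ∈ S, J i ⬝ᵥ x) * Real.exp (t * (J₀ ⬝ᵥ x)) * gaussDensity A x
      = (∏ i ∈ S, J i ⬝ᵥ x) * ((J₀ ⬝ᵥ x) * Real.exp (t * (J₀ ⬝ᵥ x))) * gaussDensity A x := by ring
  rw [Real.norm_eq_abs, hre, abs_mul, abs_mul, abs_of_nonneg h0, smul_dotProduct, smul_eq_mul]
  refine mul_le_mul_of_nonneg_right ?_ h0
  exact mul_le_mul (abs_prod_dot_le_prod_cosh J S x) h1 (abs_nonneg _)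
    (Finset.prod_nonneg fun i _ => by positivity)

omit [DecidableEq ι] in
/-- ★ `∏_{i∈S}⟨J_i,x⟩·ρ_A(x)` is integrable — every mixed moment of the law `ρ_A dx` exists. [folklore] -/
theorem integrable_prod_dot_mul_gaussDensity [DecidableEq W] (hδ : 0 < δ) (hA : Coercive A δ) (J : W → ι → ℝ)
    (S : Finset W) :
    Integrable fun x : ι → ℝ => (∏ i ∈ S, J i ⬝ᵥ x) * gaussDensity A x := by
  have h := integrable_prod_dot_mul_exp_mul_gaussDensity hδ hA J S 0 0
  refine h.congr (Eventually.of_forall fun x => ?_)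
  simp only [zero_mul, Real.exp_zero, mul_one]

end Integrability

/-! ## §2 Completing the square at the level of the density, and the translated integral -/

section Translation

variable {A : Matrix ι ι ℝ} {δ : ℝ}

/-- ★★ **COMPLETING THE SQUARE**: `e^{⟨w,x⟩}ρ_A(x) = e^{½⟨w,A⁻¹w⟩}·ρ_A(x − A⁻¹w)` (part Τ-a's `complete_square`). [cite: King1986, (2.6) p.652] -/
theorem gaussDensity_mul_exp_dot_eq_transl (hδ : 0 < δ) (hA : Coercive A δ) (hsymm : Aᵀ = A) (w x : ι → ℝ) :
    Real.exp (w ⬝ᵥ x) * gaussDensity A x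
      = Real.exp ((1 / 2 : ℝ) * (w ⬝ᵥ (A⁻¹ *ᵥ w))) * gaussDensity A (x - A⁻¹ *ᵥ w) := by
  have hunit : IsUnit A := isUnit_of_coercive hδ hA
  unfold gaussDensity
  rw [mul_div_assoc', ← Real.exp_add, mul_div_assoc', ← Real.exp_add,
    show w ⬝ᵥ x + -(1 / 2 : ℝ) * (x ⬝ᵥ (A *ᵥ x)) = -(1 / 2 : ℝ) * (x ⬝ᵥ (A *ᵥ x)) + w ⬝ᵥ x from add_comm _ _,
    complete_square hsymm hunit w x, add_comm]

/-- ★★ **THE TRANSLATED INTEGRAL**: for EVERY weight `G`, `∫G(x)e^{⟨w,x⟩}ρ_A(x)dx = e^{½⟨w,A⁻¹w⟩}·∫G(y + A⁻¹w)ρ_A(y)dy` (completing the square and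
translation invariance of Lebesgue measure on `ℝ^ι`). [cite: King1986, (2.6) p.652, (2.15) p.653] -/
theorem integral_mul_exp_dot_gaussDensity_eq_transl (hδ : 0 < δ) (hA : Coercive A δ) (hsymm : Aᵀ = A)
    (G : (ι → ℝ) → ℝ) (w : ι → ℝ) :
    ∫ x : ι → ℝ, G x * Real.exp (w ⬝ᵥ x) * gaussDensity A x
      = Real.exp ((1 / 2 : ℝ) * (w ⬝ᵥ (A⁻¹ *ᵥ w))) * ∫ y : ι → ℝ, G (y + A⁻¹ *ᵥ w) * gaussDensity A y := by
  have h1 : (fun x : ι → ℝ => G x * Real.exp (w ⬝ᵥ x) * gaussDensity A x)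
      = fun x => Real.exp ((1 / 2 : ℝ) * (w ⬝ᵥ (A⁻¹ *ᵥ w))) * (G x * gaussDensity A (x - A⁻¹ *ᵥ w)) := by
    funext x
    rw [mul_assoc, gaussDensity_mul_exp_dot_eq_transl hδ hA hsymm w x]
    ring
  rw [h1, integral_const_mul]
  congr 1
  rw [← integral_sub_right_eq_self (μ := (volume : Measure (ι → ℝ)))
    (fun y : ι → ℝ => G (y + A⁻¹ *ᵥ w) * gaussDensity A y) (A⁻¹ *ᵥ w)]
  simp only [sub_add_cancel]

end Translation

/-! ## §3 The polynomial side: `∏_{i∈S}⟨J_i, y + t·v⟩` expanded over `S.powerset`, its integral, and its derivative at `t = 0` -/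

section Polynomial

variable {A : Matrix ι ι ℝ} {δ : ℝ} {W : Type*} [DecidableEq W]

omit [DecidableEq ι] in
/-- The binomial expansion `∏_{i∈S}⟨J_i, y + t·v⟩ = Σ_{T⊆S} t^{|T|}·(∏_{i∈T}⟨J_i,v⟩)·∏_{i∈S∖T}⟨J_i,y⟩` (`Finset.prod_add`). [folklore] -/
theorem prod_dot_add_smul_eq_sum (J : W → ι → ℝ) (S : Finset W) (y v : ι → ℝ) (t : ℝ) :
    ∏ i ∈ S, J i ⬝ᵥ (y + t • v)
      = ∑ T ∈ S.powerset, t ^ T.card * (∏ i ∈ T, J i ⬝ᵥ v) * ∏ i ∈ S \ T, J i ⬝ᵥ y := by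
  have h : ∀ i, J i ⬝ᵥ (y + t • v) = t * (J i ⬝ᵥ v) + J i ⬝ᵥ y := fun i => by
    rw [dotProduct_add, dotProduct_smul, smul_eq_mul]; ring
  simp_rw [h, Finset.prod_add]
  refine Finset.sum_congr rfl fun T _ => ?_
  rw [Finset.prod_mul_distrib, Finset.prod_const]

omit [DecidableEq ι] in
/-- Its integral: `∫∏_{i∈S}⟨J_i, y + t·v⟩ρ_A(y)dy = Σ_{T⊆S} t^{|T|}(∏_{i∈T}⟨J_i,v⟩)·∫∏_{i∈S∖T}⟨J_i,y⟩ρ_A(y)dy`. [folklore] -/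
theorem integral_prod_dot_add_smul_eq_sum (hδ : 0 < δ) (hA : Coercive A δ) (J : W → ι → ℝ) (S : Finset W)
    (v : ι → ℝ) (t : ℝ) :
    ∫ y : ι → ℝ, (∏ i ∈ S, J i ⬝ᵥ (y + t • v)) * gaussDensity A y
      = ∑ T ∈ S.powerset, t ^ T.card * (∏ i ∈ T, J i ⬝ᵥ v)
          * ∫ y : ι → ℝ, (∏ i ∈ S \ T, J i ⬝ᵥ y) * gaussDensity A y := by
  have h1 : (fun y : ι → ℝ => (∏ i ∈ S, J i ⬝ᵥ (y + t • v)) * gaussDensity A y)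
      = fun y => ∑ T ∈ S.powerset, (t ^ T.card * (∏ i ∈ T, J i ⬝ᵥ v))
          * ((∏ i ∈ S \ T, J i ⬝ᵥ y) * gaussDensity A y) := by
    funext y
    rw [prod_dot_add_smul_eq_sum, Finset.sum_mul]
    refine Finset.sum_congr rfl fun T _ => ?_
    ring
  rw [h1, integral_finsetSum _ (fun T _ =>
    (integrable_prod_dot_mul_gaussDensity hδ hA J (S \ T)).const_mul _)]
  refine Finset.sum_congr rfl fun T _ => ?_
  rw [integral_const_mul]

omit [DecidableEq ι] [DecidableEq W] in
/-- The value of the termwise derivative at `t = 0`: `Σ_{T⊆S} |T|·0^{|T|−1}·a(T) = Σ_{k∈S} a({k})` (only the singletons survive). [folklore] -/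
theorem sum_card_mul_zero_pow_eq (S : Finset W) (a : Finset W → ℝ) :
    ∑ T ∈ S.powerset, (T.card : ℝ) * (0 : ℝ) ^ (T.card - 1) * a T = ∑ k ∈ S, a {k} := by
  have h1 : ∀ T ∈ S.powerset, (T.card : ℝ) * (0 : ℝ) ^ (T.card - 1) * a T = if T.card = 1 then a T else 0 := by
    intro T _
    obtain h | h | h : T.card = 0 ∨ T.card = 1 ∨ 2 ≤ T.card := by omega
    · simp [h]
    · simp [h]
    · have hne : T.card ≠ 1 := by omega
      rw [if_neg hne, zero_pow (by omega), mul_zero, zero_mul]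
  rw [Finset.sum_congr rfl h1, ← Finset.sum_filter, ← Finset.powersetCard_eq_filter, Finset.powersetCard_one,
    Finset.sum_map]
  rfl

omit [DecidableEq ι] in
/-- ★ The shifted-product integral `P(t) = ∫∏_{i∈S}⟨J_i, y + t·v⟩ρ_A(y)dy` has derivative `Σ_{k∈S}⟨J_k,v⟩∫∏_{i∈S∖k}⟨J_i,y⟩ρ_A(y)dy` at `t = 0`.
[folklore] -/
theorem hasDerivAt_shiftPoly (hδ : 0 < δ) (hA : Coercive A δ) (J : W → ι → ℝ) (S : Finset W) (v : ι → ℝ) :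
    HasDerivAt (fun t : ℝ => ∫ y : ι → ℝ, (∏ i ∈ S, J i ⬝ᵥ (y + t • v)) * gaussDensity A y)
      (∑ k ∈ S, (J k ⬝ᵥ v) * ∫ y : ι → ℝ, (∏ i ∈ S.erase k, J i ⬝ᵥ y) * gaussDensity A y) 0 := by
  have hfun : (fun t : ℝ => ∫ y : ι → ℝ, (∏ i ∈ S, J i ⬝ᵥ (y + t • v)) * gaussDensity A y)
      = fun t => ∑ T ∈ S.powerset, t ^ T.card * ((∏ i ∈ T, J i ⬝ᵥ v)
          * ∫ y : ι → ℝ, (∏ i ∈ S \ T, J i ⬝ᵥ y) * gaussDensity A y) := by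
    funext t
    rw [integral_prod_dot_add_smul_eq_sum hδ hA]
    refine Finset.sum_congr rfl fun T _ => ?_
    ring
  rw [hfun]
  have h := HasDerivAt.fun_sum (u := S.powerset) (x := (0 : ℝ))
    (A := fun T t => t ^ T.card * ((∏ i ∈ T, J i ⬝ᵥ v) * ∫ y : ι → ℝ, (∏ i ∈ S \ T, J i ⬝ᵥ y) * gaussDensity A y))
    (A' := fun T => (T.card : ℝ) * (0 : ℝ) ^ (T.card - 1)
      * ((∏ i ∈ T, J i ⬝ᵥ v) * ∫ y : ι → ℝ, (∏ i ∈ S \ T, J i ⬝ᵥ y) * gaussDensity A y))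
    (fun T _ => (hasDerivAt_pow T.card (0 : ℝ)).mul_const _)
  have hval : ∑ T ∈ S.powerset, (T.card : ℝ) * (0 : ℝ) ^ (T.card - 1)
      * ((∏ i ∈ T, J i ⬝ᵥ v) * ∫ y : ι → ℝ, (∏ i ∈ S \ T, J i ⬝ᵥ y) * gaussDensity A y)
      = ∑ k ∈ S, (J k ⬝ᵥ v) * ∫ y : ι → ℝ, (∏ i ∈ S.erase k, J i ⬝ᵥ y) * gaussDensity A y := by
    rw [sum_card_mul_zero_pow_eq S (fun T => (∏ i ∈ T, J i ⬝ᵥ v)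
      * ∫ y : ι → ℝ, (∏ i ∈ S \ T, J i ⬝ᵥ y) * gaussDensity A y)]
    refine Finset.sum_congr rfl fun k _ => ?_
    rw [Finset.prod_singleton, Finset.sdiff_singleton_eq_erase]
  rw [hval] at h
  exact h

end Polynomial

/-! ## §4 Differentiation under the integral sign in the tilt parameter, and THE RECURSION -/

section Recursion

variable {A : Matrix ι ι ℝ} {δ : ℝ} {W : Type*} [DecidableEq W]

omit [DecidableEq ι] in
/-- ★★ **DIFFERENTIATION UNDER THE INTEGRAL SIGN**: `t ↦ ∫∏_{i∈S}⟨J_i,x⟩e^{t⟨J₀,x⟩}ρ_A(x)dx` has derivative `∫⟨J₀,x⟩∏_{i∈S}⟨J_i,x⟩e^{t₀⟨J₀,x⟩}ρ_A(x)dx`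
at every `t₀` (dominated on the ball `|t − t₀| < 1` by `∏_{i∈S}(e^{u_i}+e^{−u_i})·(e^{(|t₀|+2)u₀}+e^{−(|t₀|+2)u₀})·ρ_A`). [folklore] -/
theorem hasDerivAt_prodTilt (hδ : 0 < δ) (hA : Coercive A δ) (J : W → ι → ℝ) (S : Finset W) (J₀ : ι → ℝ) (t₀ : ℝ) :
    HasDerivAt (fun t : ℝ => ∫ x : ι → ℝ, (∏ i ∈ S, J i ⬝ᵥ x) * Real.exp (t * (J₀ ⬝ᵥ x)) * gaussDensity A x)
      (∫ x : ι → ℝ, (J₀ ⬝ᵥ x) * (∏ i ∈ S, J i ⬝ᵥ x) * Real.exp (t₀ * (J₀ ⬝ᵥ x)) * gaussDensity A x) t₀ := by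
  have hJ : Continuous fun x : ι → ℝ => J₀ ⬝ᵥ x := by simp only [dotProduct]; fun_prop
  have hcF : ∀ t : ℝ, Continuous fun x : ι → ℝ =>
      (∏ i ∈ S, J i ⬝ᵥ x) * Real.exp (t * (J₀ ⬝ᵥ x)) * gaussDensity A x := fun t =>
    ((continuous_prod_dot J S).mul (Real.continuous_exp.comp (continuous_const.mul hJ))).mul (continuous_gaussDensity A)
  have hcF' : ∀ t : ℝ, Continuous fun x : ι → ℝ =>
      (J₀ ⬝ᵥ x) * (∏ i ∈ S, J i ⬝ᵥ x) * Real.exp (t * (J₀ ⬝ᵥ x)) * gaussDensity A x := fun t =>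
    ((hJ.mul (continuous_prod_dot J S)).mul (Real.continuous_exp.comp (continuous_const.mul hJ))).mul
      (continuous_gaussDensity A)
  have key := hasDerivAt_integral_of_dominated_loc_of_deriv_le (μ := (volume : Measure (ι → ℝ))) (x₀ := t₀)
    (F := fun t x => (∏ i ∈ S, J i ⬝ᵥ x) * Real.exp (t * (J₀ ⬝ᵥ x)) * gaussDensity A x)
    (F' := fun t x => (J₀ ⬝ᵥ x) * (∏ i ∈ S, J i ⬝ᵥ x) * Real.exp (t * (J₀ ⬝ᵥ x)) * gaussDensity A x)
    (bound := fun x => (∏ i ∈ S, (Real.exp (J i ⬝ᵥ x) + Real.exp (-(J i ⬝ᵥ x))))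
      * (Real.exp (((|t₀| + 2) • J₀) ⬝ᵥ x) + Real.exp (-(((|t₀| + 2) • J₀) ⬝ᵥ x))) * gaussDensity A x)
    (Metric.ball_mem_nhds t₀ zero_lt_one)
    (Eventually.of_forall fun t => (hcF t).aestronglyMeasurable)
    (integrable_prod_dot_mul_exp_mul_gaussDensity hδ hA J S J₀ t₀)
    (hcF' t₀).aestronglyMeasurable ?_
    (integrable_prod_cosh_mul_cosh_mul_gaussDensity hδ hA J S ((|t₀| + 2) • J₀)) ?_
  · exact key.2
  · refine Eventually.of_forall fun x t ht => ?_
    have ht' : |t| ≤ |t₀| + 1 := by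
      have h := Metric.mem_ball.mp ht
      rw [Real.dist_eq] at h
      have h' := abs_sub_abs_le_abs_sub t t₀
      linarith
    have h0 : 0 ≤ gaussDensity A x := gaussDensity_nonneg hδ hA x
    have h1 : |(J₀ ⬝ᵥ x) * Real.exp (t * (J₀ ⬝ᵥ x))|
        ≤ Real.exp ((|t₀| + 2) * (J₀ ⬝ᵥ x)) + Real.exp (-((|t₀| + 2) * (J₀ ⬝ᵥ x))) := by
      have h := abs_pow_mul_exp_le 1 ht' (J₀ ⬝ᵥ x)
      simp only [pow_one, Nat.cast_one] at h
      rw [show |t₀| + 1 + 1 = |t₀| + 2 by ring] at h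
      exact h
    have hre : (J₀ ⬝ᵥ x) * (∏ i ∈ S, J i ⬝ᵥ x) * Real.exp (t * (J₀ ⬝ᵥ x)) * gaussDensity A x
        = (∏ i ∈ S, J i ⬝ᵥ x) * ((J₀ ⬝ᵥ x) * Real.exp (t * (J₀ ⬝ᵥ x))) * gaussDensity A x := by ring
    rw [Real.norm_eq_abs, hre, abs_mul, abs_mul, abs_of_nonneg h0, smul_dotProduct, smul_eq_mul]
    refine mul_le_mul_of_nonneg_right ?_ h0
    exact mul_le_mul (abs_prod_dot_le_prod_cosh J S x) h1 (abs_nonneg _)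
      (Finset.prod_nonneg fun i _ => by positivity)
  · refine Eventually.of_forall fun x t _ => ?_
    have h : HasDerivAt (fun t => (∏ i ∈ S, J i ⬝ᵥ x) * Real.exp (t * (J₀ ⬝ᵥ x)) * gaussDensity A x)
        ((∏ i ∈ S, J i ⬝ᵥ x) * (Real.exp (t * (J₀ ⬝ᵥ x)) * (1 * (J₀ ⬝ᵥ x))) * gaussDensity A x) t :=
      ((((hasDerivAt_id t).mul_const (J₀ ⬝ᵥ x)).exp.const_mul (∏ i ∈ S, J i ⬝ᵥ x)).mul_const (gaussDensity A x))
    have hv : (∏ i ∈ S, J i ⬝ᵥ x) * (Real.exp (t * (J₀ ⬝ᵥ x)) * (1 * (J₀ ⬝ᵥ x))) * gaussDensity A x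
        = (J₀ ⬝ᵥ x) * (∏ i ∈ S, J i ⬝ᵥ x) * Real.exp (t * (J₀ ⬝ᵥ x)) * gaussDensity A x := by ring
    rw [hv] at h
    exact h

/-- ★★★ **GAUSSIAN INTEGRATION BY PARTS (THE WICK ∕ ISSERLIS RECURSION)**: for a symmetric coercive precision `A`, every `J₀` and every finite
family of linear forms `J_i`, `i ∈ S`:
`∫⟨J₀,x⟩·∏_{i∈S}⟨J_i,x⟩ρ_A(x)dx = Σ_{k∈S}⟨J₀,A⁻¹J_k⟩·∫∏_{i∈S∖{k}}⟨J_i,x⟩ρ_A(x)dx`. [cite: King1986, (2.6) p.652, (2.15) p.653] -/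
theorem integral_dot_mul_prod_gaussDensity (hδ : 0 < δ) (hA : Coercive A δ) (hsymm : Aᵀ = A) (J₀ : ι → ℝ)
    (J : W → ι → ℝ) (S : Finset W) :
    ∫ x : ι → ℝ, (J₀ ⬝ᵥ x) * (∏ i ∈ S, J i ⬝ᵥ x) * gaussDensity A x
      = ∑ k ∈ S, (J₀ ⬝ᵥ (A⁻¹ *ᵥ J k)) * ∫ x : ι → ℝ, (∏ i ∈ S.erase k, J i ⬝ᵥ x) * gaussDensity A x := by
  -- (1) the derivative of `F(t) = ∫∏u_i e^{tu₀}ρ_A` at `0` under the integral sign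
  have hF := hasDerivAt_prodTilt hδ hA J S J₀ 0
  simp only [zero_mul, Real.exp_zero, mul_one] at hF
  -- (2) completing the square: `F(t) = e^{½t²Q₀}·P(t)` with `P(t) = ∫∏⟨J_i, y + t·A⁻¹J₀⟩ρ_A`
  have hFeq : (fun t : ℝ => ∫ x : ι → ℝ, (∏ i ∈ S, J i ⬝ᵥ x) * Real.exp (t * (J₀ ⬝ᵥ x)) * gaussDensity A x)
      = fun t => Real.exp ((1 / 2 : ℝ) * t ^ 2 * (J₀ ⬝ᵥ (A⁻¹ *ᵥ J₀)))
          * ∫ y : ι → ℝ, (∏ i ∈ S, J i ⬝ᵥ (y + t • (A⁻¹ *ᵥ J₀))) * gaussDensity A y := by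
    funext t
    have h := integral_mul_exp_dot_gaussDensity_eq_transl hδ hA hsymm (fun x => ∏ i ∈ S, J i ⬝ᵥ x) (t • J₀)
    simp only [smul_dotProduct, smul_eq_mul, Matrix.mulVec_smul, dotProduct_smul] at h
    rw [h]
    congr 1
    · congr 1; ring
  -- (3) the derivative of the right-hand side at `0` is `P′(0)` (the Gaussian factor has derivative `0` there)
  have hP := hasDerivAt_shiftPoly hδ hA J S (A⁻¹ *ᵥ J₀)
  have hE : HasDerivAt (fun t : ℝ => Real.exp ((1 / 2 : ℝ) * t ^ 2 * (J₀ ⬝ᵥ (A⁻¹ *ᵥ J₀))))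
      (Real.exp ((1 / 2 : ℝ) * (0 : ℝ) ^ 2 * (J₀ ⬝ᵥ (A⁻¹ *ᵥ J₀)))
        * ((1 / 2 : ℝ) * ((2 : ℕ) * (0 : ℝ) ^ (2 - 1)) * (J₀ ⬝ᵥ (A⁻¹ *ᵥ J₀)))) 0 :=
    (((hasDerivAt_pow 2 (0 : ℝ)).const_mul (1 / 2 : ℝ)).mul_const (J₀ ⬝ᵥ (A⁻¹ *ᵥ J₀))).exp
  have hR := hE.mul hP
  rw [hFeq] at hF
  have huniq := hF.unique hR
  rw [huniq]
  norm_num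
  refine Finset.sum_congr rfl fun k _ => ?_
  rw [dot_mulVec_comm_of_transpose_eq (transpose_inv_of_transpose_eq hsymm) (J k) J₀]

end Recursion

end Summit.QuantumFields.YangMills.BalabanUVNodes.N15KingModelRung.FreeField
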